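import Literature.Analysis.FluidPDE.CompressibleEulerImplosionODEContinuation
import HarnessLib

/-!
# Buckmaster–Cao-Labora–Gómez-Serrano: maximal continuation of a solution of `c′ = F(c)`

Topic `Literature/Analysis/FluidPDE`; namespace
`Literature.Analysis.FluidPDE.BuckmasterCaolaboraGomezserrano2025.ODE`. Companion of
`CompressibleEulerImplosion.lean` (named fact `BuckmasterCaolaboraGomezserrano2025_thm11_monatomic`,
THEOREM 1.1 of T. Buckmaster, G. Cao-Labora, J. Gómez-Serrano, *Smooth imploding solutions for 3D
compressible fluids*, Forum Math. Pi 13 (2025) e6, arXiv:2208.09445); sequel of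
`CompressibleEulerImplosionODEContinuation.lean` (uniqueness on open intervals).

Brick A-max of the discharge plan: every `U`-valued solution of the autonomous system `c′ = F(c)`
(`F` of class `C¹` on the open set `U`) given on `(a, T₀)` has a maximal forward continuation —
either a `U`-valued solution on all of `(a, ∞)`, or a `U`-valued solution on some `(a, T*)`,
`T* ≥ T₀`, admitting no `U`-valued extension to a longer interval (`exists_maximal`). This is the
(implicit) first sentence of every "consider the trajectory until it leaves the region" argument
of the paper (Props. 2.5, 3.1, §§3–4). Theorems only, folklore.
[cite: BuckmasterCaolaboraGomezserrano2025, Prop. 2.5 (proof), Prop. 1.6]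
-/

noncomputable section

open Set Filter Metric Topology

namespace Literature.Analysis.FluidPDE

namespace BuckmasterCaolaboraGomezserrano2025

namespace ODE

variable {E : Type*} [NormedAddCommGroup E] [NormedSpace ℝ E] {F : E → E} {U : Set E}

/-- Two continuations of the same solution germ agree on their common interval. [folklore] -/
theorem eqOn_min_of_eqOn (hF : ∀ x ∈ U, ContDiffAt ℝ 1 F x) {c₀ c₁ c₂ : ℝ → E}
    {a T₀ T₁ T₂ : ℝ} (haT : a < T₀) (h₀₁ : T₀ ≤ T₁) (h₀₂ : T₀ ≤ T₂)
    (h₁ : ∀ t ∈ Ioo a T₁, HasDerivAt c₁ (F (c₁ t)) t) (hU₁ : ∀ t ∈ Ioo a T₁, c₁ t ∈ U)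
    (he₁ : EqOn c₁ c₀ (Ioo a T₀))
    (h₂ : ∀ t ∈ Ioo a T₂, HasDerivAt c₂ (F (c₂ t)) t) (he₂ : EqOn c₂ c₀ (Ioo a T₀)) :
    EqOn c₁ c₂ (Ioo a (min T₁ T₂)) := by
  have ht₁ : (a + T₀) / 2 ∈ Ioo a T₀ := ⟨by linarith, by linarith⟩
  have hsub₁ : Ioo a (min T₁ T₂) ⊆ Ioo a T₁ := Ioo_subset_Ioo_right (min_le_left _ _)
  have hsub₂ : Ioo a (min T₁ T₂) ⊆ Ioo a T₂ := Ioo_subset_Ioo_right (min_le_right _ _)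
  refine eqOn_of_contDiffAt (t₀ := (a + T₀) / 2) ⟨ht₁.1, lt_min (by linarith) (by linarith)⟩
    (fun t ht => hF _ (hU₁ t (hsub₁ ht))) (fun t ht => h₁ t (hsub₁ ht))
    (fun t ht => h₂ t (hsub₂ ht)) ?_
  rw [he₁ ht₁, he₂ ht₁]

/-- Local solutions from a point of `U` stay in `U` for a short time. [folklore] -/
theorem exists_solution_mem [CompleteSpace E] (hU : IsOpen U) (hF : ∀ x ∈ U, ContDiffAt ℝ 1 F x)
    {x₀ : E} (hx₀ : x₀ ∈ U) (t₀ : ℝ) :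
    ∃ α : ℝ → E, ∃ ε > (0 : ℝ), α t₀ = x₀ ∧
      (∀ t ∈ Ioo (t₀ - ε) (t₀ + ε), HasDerivAt α (F (α t)) t) ∧
      ∀ t ∈ Ioo (t₀ - ε) (t₀ + ε), α t ∈ U := by
  obtain ⟨r, hr, ε, hε, H⟩ :=
    (hF x₀ hx₀).exists_forall_mem_closedBall_exists_eq_forall_mem_Ioo_hasDerivAt t₀
  obtain ⟨α, hα0, hα⟩ := H x₀ (mem_closedBall_self hr.le)
  have hcont : ContinuousAt α t₀ := (hα t₀ ⟨by linarith, by linarith⟩).continuousAt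
  have hUn : ∀ᶠ t in 𝓝 t₀, α t ∈ U := hcont.preimage_mem_nhds (by rw [hα0]; exact hU.mem_nhds hx₀)
  obtain ⟨ρ, hρ, hρU⟩ := Metric.eventually_nhds_iff.mp hUn
  refine ⟨α, min ε ρ, lt_min hε hρ, hα0, fun t ht => hα t ⟨?_, ?_⟩, fun t ht => hρU ?_⟩
  · linarith [ht.1, min_le_left ε ρ]
  · linarith [ht.2, min_le_left ε ρ]
  · rw [Real.dist_eq, abs_sub_lt_iff]
    constructor <;> linarith [ht.1, ht.2, min_le_right ε ρ]

/-- **Maximal forward continuation.** Let `F` be `C¹` on the open set `U` and let `c₀` be a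
`U`-valued solution of `c′ = F(c)` on `(a, T₀)`, `a < T₀`. Then either `c₀` continues to a
`U`-valued solution on `(a, ∞)`, or there are `T* ≥ T₀` and a `U`-valued solution `c` on `(a, T*)`
continuing `c₀` which admits no `U`-valued extension to any `(a, T')`, `T' > T*`. [folklore] -/
theorem exists_maximal (hF : ∀ x ∈ U, ContDiffAt ℝ 1 F x)
    {c₀ : ℝ → E} {a T₀ : ℝ} (haT : a < T₀)
    (hc₀ : ∀ t ∈ Ioo a T₀, HasDerivAt c₀ (F (c₀ t)) t) (hU₀ : ∀ t ∈ Ioo a T₀, c₀ t ∈ U) :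
    (∃ c : ℝ → E, EqOn c c₀ (Ioo a T₀) ∧ (∀ t ∈ Ioi a, HasDerivAt c (F (c t)) t) ∧
      ∀ t ∈ Ioi a, c t ∈ U) ∨
    (∃ T : ℝ, T₀ ≤ T ∧ ∃ c : ℝ → E, EqOn c c₀ (Ioo a T₀) ∧
      (∀ t ∈ Ioo a T, HasDerivAt c (F (c t)) t) ∧ (∀ t ∈ Ioo a T, c t ∈ U) ∧
      ∀ (c' : ℝ → E) (T' : ℝ), T < T' → EqOn c' c (Ioo a T) →
        (∀ t ∈ Ioo a T', HasDerivAt c' (F (c' t)) t) → ¬ ∀ t ∈ Ioo a T', c' t ∈ U) := by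
  -- admissible endpoints
  set S : Set ℝ := {T | T₀ ≤ T ∧ ∃ c : ℝ → E, EqOn c c₀ (Ioo a T₀) ∧
    (∀ t ∈ Ioo a T, HasDerivAt c (F (c t)) t) ∧ ∀ t ∈ Ioo a T, c t ∈ U} with hS
  have hT₀S : T₀ ∈ S := ⟨le_rfl, c₀, fun _ _ => rfl, hc₀, hU₀⟩
  by_cases hbdd : BddAbove S
  · -- finite maximal time `T* = sup S`
    right
    set Ts := sSup S with hTs
    have hT₀le : T₀ ≤ Ts := le_csSup hbdd hT₀S
    have hsel : ∀ t, t < Ts → ∃ T c, (T₀ ≤ T ∧ t < T) ∧ EqOn c c₀ (Ioo a T₀) ∧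
        (∀ s ∈ Ioo a T, HasDerivAt c (F (c s)) s) ∧ ∀ s ∈ Ioo a T, c s ∈ U := by
      intro t ht
      obtain ⟨T, hTS, htT⟩ := exists_lt_of_lt_csSup ⟨T₀, hT₀S⟩ ht
      obtain ⟨hT₀T, c, he, hd, hu⟩ := hTS
      exact ⟨T, c, ⟨hT₀T, htT⟩, he, hd, hu⟩
    choose! Tsel csel hTt he hd hu using hsel
    set g : ℝ → E := fun t => csel t t with hg
    -- `g` agrees with `csel t` near every `t < Ts`
    have hloc : ∀ t ∈ Ioo a Ts, ∀ s ∈ Ioo a (min Ts (Tsel t)), g s = csel t s := by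
      intro t ht s hs
      have hsTs : s < Ts := lt_of_lt_of_le hs.2 (min_le_left _ _)
      have hsT : s < Tsel t := lt_of_lt_of_le hs.2 (min_le_right _ _)
      have key := eqOn_min_of_eqOn hF haT (hTt s hsTs).1 (hTt t ht.2).1 (hd s hsTs) (hu s hsTs)
        (he s hsTs) (hd t ht.2) (he t ht.2)
      exact key ⟨hs.1, lt_min (hTt s hsTs).2 hsT⟩
    have hgd : ∀ t ∈ Ioo a Ts, HasDerivAt g (F (g t)) t := by
      intro t ht
      have htmin : t ∈ Ioo a (min Ts (Tsel t)) := ⟨ht.1, lt_min ht.2 (hTt t ht.2).2⟩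
      have hev : g =ᶠ[𝓝 t] csel t :=
        Filter.eventually_of_mem (isOpen_Ioo.mem_nhds htmin) fun s hs => hloc t ht s hs
      have h := hd t ht.2 t ⟨ht.1, (hTt t ht.2).2⟩
      rw [← hloc t ht t htmin] at h
      exact h.congr_of_eventuallyEq hev
    have hgU : ∀ t ∈ Ioo a Ts, g t ∈ U := fun t ht => hu t ht.2 t ⟨ht.1, (hTt t ht.2).2⟩
    have hge : EqOn g c₀ (Ioo a T₀) := fun t ht =>
      he t (lt_of_lt_of_le ht.2 hT₀le) ht
    refine ⟨Ts, hT₀le, g, hge, hgd, hgU, fun c' T' hT' heq hd' hu' => ?_⟩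
    have hT'S : T' ∈ S := by
      refine ⟨hT₀le.trans hT'.le, c', fun t ht => ?_, hd', hu'⟩
      rw [heq ⟨ht.1, lt_of_lt_of_le ht.2 hT₀le⟩, hge ht]
    exact absurd (le_csSup hbdd hT'S) (not_le.mpr hT')
  · -- no finite bound: a global solution
    left
    rw [not_bddAbove_iff] at hbdd
    have hsel : ∀ n : ℕ, ∃ T c, (n : ℝ) < T ∧ EqOn c c₀ (Ioo a T₀) ∧
        (∀ s ∈ Ioo a T, HasDerivAt c (F (c s)) s) ∧ ∀ s ∈ Ioo a T, c s ∈ U := by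
      intro n
      obtain ⟨T, ⟨_, c, he, hd, hu⟩, hnT⟩ := hbdd n
      exact ⟨T, c, hnT, he, hd, hu⟩
    choose Tn cn hnT he hd hu using hsel
    set N : ℝ → ℕ := fun t => ⌈|t|⌉₊ with hN
    have hNt : ∀ t, t < Tn (N t) := fun t =>
      lt_of_le_of_lt ((le_abs_self t).trans (Nat.le_ceil |t|)) (hnT (N t))
    set g : ℝ → E := fun t => cn (N t) t with hg
    -- any two of the `cn` agree on their common interval
    have hagree : ∀ m n, EqOn (cn m) (cn n) (Ioo a (min (Tn m) (Tn n))) := by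
      intro m n s hs
      have hsm : s < Tn m := lt_of_lt_of_le hs.2 (min_le_left _ _)
      have hsn : s < Tn n := lt_of_lt_of_le hs.2 (min_le_right _ _)
      set T₁ : ℝ := min T₀ (min (Tn m) (Tn n)) with hT₁
      have haT₁ : a < T₁ := lt_min haT (lt_min (hs.1.trans hsm) (hs.1.trans hsn))
      have hsub : Ioo a T₁ ⊆ Ioo a T₀ := Ioo_subset_Ioo_right (min_le_left _ _)
      exact eqOn_min_of_eqOn hF (T₀ := T₁) haT₁
        ((min_le_right _ _).trans (min_le_left _ _)) ((min_le_right _ _).trans (min_le_right _ _))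
        (hd m) (hu m) (fun x hx => he m (hsub hx)) (hd n) (fun x hx => he n (hsub hx)) hs
    have hloc : ∀ t ∈ Ioi a, ∀ s ∈ Ioo a (Tn (N t)), g s = cn (N t) s := by
      intro t _ s hs
      exact hagree (N s) (N t) ⟨hs.1, lt_min (hNt s) hs.2⟩
    refine ⟨g, fun t ht => ?_, fun t ht => ?_, fun t ht => ?_⟩
    · show cn (N t) t = c₀ t
      exact he (N t) ht
    · have htV : t ∈ Ioo a (Tn (N t)) := ⟨ht, hNt t⟩
      have hev : g =ᶠ[𝓝 t] cn (N t) :=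
        Filter.eventually_of_mem (isOpen_Ioo.mem_nhds htV) fun s hs => hloc t ht s hs
      have h := hd (N t) t htV
      rw [← hloc t ht t htV] at h
      exact h.congr_of_eventuallyEq hev
    · exact hu (N t) t ⟨ht, hNt t⟩

end ODE

end BuckmasterCaolaboraGomezserrano2025

end Literature.Analysis.FluidPDE
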